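import Literature.NumberTheory.EllipticCurves.ZpExtensionEisensteinSelmerStructure
import Literature.NumberTheory.EllipticCurves.ZpExtensionEisensteinBottomConjugationProofs
import Literature.NumberTheory.EllipticCurves.ZpExtensionScalarTwistFiniteProofs
import Literature.NumberTheory.GaloisRepresentations.LocalDualityTwoZero
import Literature.NumberTheory.Automorphic.AdicCompletionLocalField
import HarnessLib

/-!
# `H²(K_w, Fil_w W₁) = 0` for the bottom Eisenstein level from `Hom_{Γ_w}(Fil_w M₁, μ_p) = 0`
# (theorems only; no definition, no named fact, no instance, no `sorry`)

Topic `NumberTheory/EllipticCurves` (D1 road of cell `pub/bsd-print-x9`; brick (D4) = the LIFTING input of Howard's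
H.5(b) at the places `w ∣ p`, NON-ANOMALOUS case, memo `HOME/x9-p1-w3/H5B-AT-P-PLAN-w3g5.md` §2 and seat
`bsd-line-x10b-p1-w8` g2's (H5B-P)).

Howard [B. Howard, Compositio Math. 140 (2004), Lemma 3.2.7, arXiv:1202.6340 p. 16 L150–156]: the cokernel of
`H¹(K_v, Fil_v 𝐓) → H¹(K_v, Fil_v(T) ⊗ Λ/𝔭)` «is controlled by `H²(K_v, Fil_v 𝐓)[𝔭]`, and by local duality it suffices to
bound `H⁰(K_v, gr_v 𝐀)`», i.e. the `p`-power torsion of the reduction `Ẽ_v` rational over the residue field — TRIVIAL in the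
non-anomalous case `a_v ≢ 1 (mod p)`.  In the tree's finite-level currency (presented towers, x10b-p1-w6's
`TowerPresentedSubquotientCohomologyProofs`: `map_subFamily_surjective_of_subsingleton`) the lifting of classes up the
sub-tower `Fil_w W_j = A_{m,j} ⊗ Fil_w M_j` (`OrdinaryFiltration.twistedFil`) needs exactly ONE vanishing:
`H²(K_w, Fil_w W₁) = 0` for the BOTTOM level `W₁ = M₁ ⊗ A_{m,1}(ψ)`, `A_{m,1} = 𝔽_p[T]/(T^m)` — the kernel of every row
`0 → Fil_w W₁ → Fil_w W_{1+n} → Fil_w W_n → 0`.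

* §1 **`ZpExtension.OrdinaryFiltration.forall_equivariant_twistedFil_one_eq_zero`** — Hom-dévissage down the powers of `T`:
  if every `Γ_w`-equivariant additive map `Fil_w M₁ → Ω` vanishes (`Ω` any discrete `Γ_w`-module; `Ω = μ_p`: «`Fil_w E[p] ≇ μ_p`
  as `Γ_w`-modules», equivalent by the Weil pairing to `Ẽ_w[p]^{Γ_w} = 0`), then every `Γ_w`-equivariant additive map
  `Fil_w W₁ → Ω` vanishes: `σ · ([T]^i c ⊗ a) = [T]^i c ⊗ σ a + [T]^{i+1}(·) ⊗ σ a` (`(1+T)^e ≡ 1 mod T`), so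
  `a ↦ f([T]^i c ⊗ a)` is equivariant once `f` kills `[T]^{i+1} A ⊗ Fil`, descending induction from `[T]^m = 0`.
* §2 **`ZpExtension.OrdinaryFiltration.subsingleton_continuousCohomology_two_twistedFil_one`** — hence, by the tree's local
  duality in bidegree `(2,0)` (`natCard_two_eq_natCard_invariants_homRep`: `#H²(K_w, X) = #Hom_{Γ_w}(X, μ_p)` for `p X = 0`),
  `H²(K_w, Fil_w W₁) = 0` as `Subsingleton (continuousCohomology 2 (subrepresentation (Fil_w W₁)))` — VERBATIM the input `h2` of
  `Tower.map_subFamily_surjective_of_subsingleton` at `ℓ = 1`.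

Stated for ANY tower `(M_k, t_k)` with ordinary datum `Φ` at `w` (`ZpExtension.OrdinaryFiltration`), any `m ≥ 1`, any character
level; the hypothesis is on the `E`-level module `Fil_w M₁` only.  No summit statement is proved; BSD is not proved by any of this.

References: [Howard2004HeegnerKolyvagin] Lemma 3.2.7 (arXiv:1202.6340 p. 16 L150–156), §3.1 (p. 15 L56–66); [MilneADT2006] I Cor. 2.3
(local duality, `H²(K, M) ≅ Hom_G(M, μ)^∨`); [SerreGaloisCohomology1997] II §5.2 Thm. 2; [GreenbergLNM1716] §2.
-/

set_option autoImplicit false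

noncomputable section

open Function NumberField IsDedekindDomain Field
open scoped NumberField TensorProduct ContRepresentation

namespace Literature.NumberTheory.EllipticCurves

namespace ZpExtension

open Literature.NumberTheory.GaloisRepresentations Literature.NumberTheory.GaloisRepresentations.DiscreteGaloisModule
open Literature.NumberTheory.EllipticCurves.IwasawaAlgebra Literature.NumberTheory.Automorphic

variable {K : Type} [Field K] [NumberField K] {p : ℕ} [hp : Fact p.Prime] (κ : ZpExtension K p)
  {M : ℕ → Type} [∀ k, AddCommGroup (M k)] [∀ k, TopologicalSpace (M k)] [∀ k, DiscreteTopology (M k)]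
  {ρ : ∀ k, DiscreteGaloisModule K (M k)}
  {t : ∀ k, (ρ (k + 1)).toContRepresentation →ⁱL (ρ k).toContRepresentation} {m : ℕ} (hm : 1 ≤ m)
  {w : HeightOneSpectrum (𝓞 K)} (Φ : OrdinaryFiltration ρ t w)

namespace OrdinaryFiltration

/-! ## §1 Hom-dévissage: equivariant maps out of `Fil_w W₁` vanish if those out of `Fil_w M₁` do -/

/-- **Hom-dévissage down the powers of `T`.**  Let `Ω` be a discrete `Γ_{K_w}`-module such that every additive
`Γ_{K_w}`-equivariant map `Fil_w M₁ → Ω` is zero.  Then every additive `Γ_{K_w}`-equivariant map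
`f : Fil_w W₁ = A_{m,1} ⊗ Fil_w M₁ → Ω` (for the twisted action `σ (c ⊗ a) = (1+T)^{κσ} c ⊗ σ a`) is zero: by descending
induction on `i`, `f` kills `[T]^i A_{m,1} ⊗ Fil_w M₁` — for `i = m` since `[T]^m = 0`, and at `i` because modulo
`[T]^{i+1} A ⊗ Fil` the twisted action on `[T]^i c ⊗ a` is the untwisted one (`(1+T)^e − 1 ∈ [T] A_{m,1}`), so
`a ↦ f([T]^i c ⊗ a)` is equivariant, hence zero. [cite: Howard2004HeegnerKolyvagin, Lemma 3.2.7 (arXiv:1202.6340 p. 16 L150–156: «by local duality it suffices to bound H⁰(K_v, gr_v 𝐀)»)]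
[cite: MilneADT2006, Ch. I Cor. 2.3] -/
theorem forall_equivariant_twistedFil_one_eq_zero {Ω : Type} [AddCommGroup Ω]
    (ω : absoluteGaloisGroup (w.adicCompletion K) → Ω →+ Ω)
    (hN : ∀ g : Φ.fil 1 →+ Ω,
      (∀ (σ : absoluteGaloisGroup (w.adicCompletion K)) (a : Φ.fil 1),
        g ⟨GaloisRep.toLocal w (ρ 1) σ a, Φ.smul_mem 1 σ a a.2⟩ = ω σ (g a)) → g = 0)
    (f : Φ.twistedFil (p := p) (m := m) 1 →+ Ω)
    (hf : ∀ (σ : absoluteGaloisGroup (w.adicCompletion K)) (x : Φ.twistedFil (p := p) (m := m) 1),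
      f ⟨GaloisRep.toLocal w (κ.eisensteinTwist (ρ 1) hm 1) σ x, Φ.twistedFil_le_comap hm 1 σ x.2⟩ = ω σ (f x)) :
    f = 0 := by
  -- notation
  let Tbar : EisensteinCoeff p m 1 := Ideal.Quotient.mk _ PowerSeries.X
  let u : EisensteinCoeff p m 1 := EisensteinCoeff.onePlusT p m 1
  have hu : u - 1 = Tbar := by
    change EisensteinCoeff.onePlusT p m 1 - 1 = Ideal.Quotient.mk _ PowerSeries.X
    rw [EisensteinCoeff.onePlusT_def, map_add, map_one, add_sub_cancel_left]
  have hTm : Tbar ^ m = 0 := EisensteinCoeff.mk_X_pow_eq_zero p m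
  -- the elements `[T]^i c ⊗ a` of `Fil_w W₁`
  let el : ℕ → EisensteinCoeff p m 1 → Φ.fil 1 → Φ.twistedFil (p := p) (m := m) 1 := fun i c a ↦
    ⟨EisensteinCoeff.Twisted.tmul (Tbar ^ i * c) (a : M 1), Φ.tmul_mem_twistedFil 1 _ a.2⟩
  -- descending induction: `f` kills `[T]^i A ⊗ Fil`
  have key : ∀ d i, i + d = m → ∀ (c : EisensteinCoeff p m 1) (a : Φ.fil 1), f (el i c a) = 0 := by
    intro d
    induction d with
    | zero =>
      intro i hi c a
      have h0 : el i c a = 0 := Subtype.ext (by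
        change EisensteinCoeff.Twisted.tmul (Tbar ^ i * c) (a : M 1) = 0
        rw [Nat.add_zero] at hi
        rw [hi, hTm, zero_mul]
        exact TensorProduct.zero_tmul _ _)
      rw [h0, map_zero]
    | succ d ih =>
      intro i hi c a
      have ih' : ∀ (c : EisensteinCoeff p m 1) (a : Φ.fil 1), f (el (i + 1) c a) = 0 := ih (i + 1) (by omega)
      -- `a ↦ f ([T]^i c ⊗ a)` is equivariant
      let g : Φ.fil 1 →+ Ω :=
        { toFun := fun a ↦ f (el i c a)
          map_zero' := by
            have h0 : el i c 0 = 0 := Subtype.ext (by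
              change EisensteinCoeff.Twisted.tmul (Tbar ^ i * c) ((0 : Φ.fil 1) : M 1) = 0
              rw [ZeroMemClass.coe_zero]
              exact TensorProduct.tmul_zero _ _)
            rw [h0, map_zero]
          map_add' := fun a b ↦ by
            have hab : el i c (a + b) = el i c a + el i c b := Subtype.ext (by
              change EisensteinCoeff.Twisted.tmul (Tbar ^ i * c) ((a + b : Φ.fil 1) : M 1) =
                EisensteinCoeff.Twisted.tmul (Tbar ^ i * c) (a : M 1) + EisensteinCoeff.Twisted.tmul (Tbar ^ i * c) (b : M 1)
              rw [Submodule.coe_add]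
              exact TensorProduct.tmul_add _ _ _)
            rw [hab, map_add] }
      have hg : ∀ (σ : absoluteGaloisGroup (w.adicCompletion K)) (a : Φ.fil 1),
          g ⟨GaloisRep.toLocal w (ρ 1) σ a, Φ.smul_mem 1 σ a a.2⟩ = ω σ (g a) := by
        intro σ a
        -- `(1+T)^e - 1 = [T] r`
        obtain ⟨r, hr⟩ : Tbar ∣ u ^ κ.twistExponent (eisensteinLevel (p := p) hm 1)
            (absGaloisRestrict K (w.adicCompletion K) σ) - 1 := by
          rw [← hu]
          simpa only [one_pow] using sub_dvd_pow_sub_pow u 1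
            (κ.twistExponent (eisensteinLevel (p := p) hm 1) (absGaloisRestrict K (w.adicCompletion K) σ))
        -- the twisted action on `[T]^i c ⊗ a`
        have hact : (⟨GaloisRep.toLocal w (κ.eisensteinTwist (ρ 1) hm 1) σ (el i c a),
            Φ.twistedFil_le_comap hm 1 σ (el i c a).2⟩ : Φ.twistedFil (p := p) (m := m) 1) =
            el i c ⟨GaloisRep.toLocal w (ρ 1) σ a, Φ.smul_mem 1 σ a a.2⟩ +
              el (i + 1) (r * c) ⟨GaloisRep.toLocal w (ρ 1) σ a, Φ.smul_mem 1 σ a a.2⟩ := by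
          apply Subtype.ext
          change GaloisRep.toLocal w (κ.eisensteinTwist (ρ 1) hm 1) σ
              (EisensteinCoeff.Twisted.tmul (Tbar ^ i * c) (a : M 1)) =
            EisensteinCoeff.Twisted.tmul (Tbar ^ i * c) (GaloisRep.toLocal w (ρ 1) σ a : M 1) +
              EisensteinCoeff.Twisted.tmul (Tbar ^ (i + 1) * (r * c)) (GaloisRep.toLocal w (ρ 1) σ a : M 1)
          rw [GaloisRep.toLocal_apply, κ.eisensteinTwist_apply_tmul (ρ 1) hm 1, GaloisRep.toLocal_apply]
          have hcoef : u ^ κ.twistExponent (eisensteinLevel (p := p) hm 1) (absGaloisRestrict K (w.adicCompletion K) σ) *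
              (Tbar ^ i * c) = Tbar ^ i * c + Tbar ^ (i + 1) * (r * c) := by
            have h1 : u ^ κ.twistExponent (eisensteinLevel (p := p) hm 1) (absGaloisRestrict K (w.adicCompletion K) σ) =
                1 + Tbar * r := by rw [← hr]; ring
            rw [h1]; ring
          rw [hcoef]
          exact TensorProduct.add_tmul _ _ _
        change f (el i c ⟨GaloisRep.toLocal w (ρ 1) σ a, Φ.smul_mem 1 σ a a.2⟩) = ω σ (f (el i c a))
        rw [← hf σ (el i c a), hact, map_add, ih' (r * c), add_zero]
      have hg0 : g = 0 := hN g hg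
      exact DFunLike.congr_fun hg0 a
  -- `f` kills every pure tensor `c ⊗ a`, `a ∈ Fil`
  have htmul : ∀ (c : EisensteinCoeff p m 1) (a : M 1) (ha : a ∈ Φ.fil 1),
      f ⟨EisensteinCoeff.Twisted.tmul c a, Φ.tmul_mem_twistedFil 1 c ha⟩ = 0 := by
    intro c a ha
    have h := key m 0 (Nat.zero_add m) c ⟨a, ha⟩
    have hel : el 0 c ⟨a, ha⟩ = ⟨EisensteinCoeff.Twisted.tmul c a, Φ.tmul_mem_twistedFil 1 c ha⟩ :=
      Subtype.ext (by change EisensteinCoeff.Twisted.tmul (Tbar ^ 0 * c) a = _; rw [pow_zero, one_mul])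
    rwa [hel] at h
  -- hence `f = 0` on the span
  refine AddMonoidHom.ext fun x ↦ ?_
  obtain ⟨x, hx⟩ := x
  rw [AddMonoidHom.zero_apply]
  induction hx using Submodule.span_induction with
  | mem x hx =>
    obtain ⟨c, a, ha, rfl⟩ := hx
    exact htmul c a ha
  | zero => exact (congrArg f (Subtype.ext rfl : (⟨0, _⟩ : Φ.twistedFil (p := p) (m := m) 1) = 0)).trans (map_zero f)
  | add x y hx hy ihx ihy =>
    have hxy : (⟨x + y, Submodule.add_mem _ hx hy⟩ : Φ.twistedFil (p := p) (m := m) 1) = ⟨x, hx⟩ + ⟨y, hy⟩ := rfl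
    rw [hxy, map_add, ihx, ihy, add_zero]
  | smul n x hx ihx =>
    have hnx : (⟨n • x, Submodule.smul_mem _ n hx⟩ : Φ.twistedFil (p := p) (m := m) 1) = n • ⟨x, hx⟩ := rfl
    rw [hnx, map_zsmul, ihx, smul_zero]

/-! ## §2 `H²(K_w, Fil_w W₁) = 0` by local duality -/

/-- **`H²(K_w, Fil_w W₁) = 0` in the non-anomalous case** (bottom Eisenstein level `W₁ = M₁ ⊗ A_{m,1}(ψ)`, `M₁` finite):
if every additive `Γ_{K_w}`-equivariant map `Fil_w M₁ → μ_p` vanishes («`Fil_w E[p] ≇ μ_p`», by the Weil pairing the same as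
`Ẽ_w(k_w)[p] = 0`), then `H²(K_w, Fil_w W₁) = 0`: local duality in bidegree `(2,0)` gives `#H²(K_w, X) = #Hom_{Γ_w}(X, μ_p)` for
the `p`-torsion module `X = Fil_w W₁`, and the right side is `1` by §1.  This is the input `h2` (at `ℓ = 1`) of
`Tower.map_subFamily_surjective_of_subsingleton`: the transition maps `H¹(K_w, Fil_w W_{j+1}) → H¹(K_w, Fil_w W_j)` are onto.
[cite: Howard2004HeegnerKolyvagin, Lemma 3.2.7 (arXiv:1202.6340 p. 16 L150–156)] [cite: MilneADT2006, Ch. I Cor. 2.3]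
[cite: SerreGaloisCohomology1997, Ch. II §5.2 Thm. 2] -/
theorem subsingleton_continuousCohomology_two_twistedFil_one [Finite (M 1)]
    (hN : ∀ g : Φ.fil 1 →+ MuCarrier (w.adicCompletion K) (p ^ 1),
      (∀ (σ : absoluteGaloisGroup (w.adicCompletion K)) (a : Φ.fil 1),
        g ⟨GaloisRep.toLocal w (ρ 1) σ a, Φ.smul_mem 1 σ a a.2⟩ = mu (w.adicCompletion K) (p ^ 1) σ (g a)) → g = 0) :
    Subsingleton (continuousCohomology 2
      ((GaloisRep.toLocal w (κ.eisensteinTwist (ρ 1) hm 1)).subrepresentation (Φ.twistedFil 1)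
        (Φ.twistedFil_le_comap hm 1)).toTopRep) := by
  haveI : Finite (EisensteinCoeff.Twisted p m 1 (M 1)) := EisensteinCoeff.finite_twisted (p := p) (k := 1) hm
  haveI : CharZero (w.adicCompletion K) := charZero_of_injective_algebraMap (algebraMap K _).injective
  set τX := (GaloisRep.toLocal w (κ.eisensteinTwist (ρ 1) hm 1)).subrepresentation (Φ.twistedFil 1)
    (Φ.twistedFil_le_comap hm 1) with hτX
  have hM : ∀ x : Φ.twistedFil (p := p) (m := m) 1, p ^ 1 • x = 0 := fun x ↦
    Subtype.ext (by
      rw [Submodule.coe_smul_of_tower, Submodule.coe_zero]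
      exact EisensteinCoeff.prime_pow_nsmul_twisted (x : EisensteinCoeff.Twisted p m 1 (M 1)))
  obtain ⟨hfin, hcard⟩ := natCard_two_eq_natCard_invariants_homRep (w.adicCompletion K) τX hM
  -- the invariants of the dual are the equivariant maps, all zero by §1
  have hinv : ∀ f : (τX.homRep (mu (w.adicCompletion K) (p ^ 1))).toTopRep.ρ.invariants, f = 0 := by
    intro f
    apply Subtype.ext
    -- the underlying additive map
    let f₀ : Φ.twistedFil (p := p) (m := m) 1 →+ MuCarrier (w.adicCompletion K) (p ^ 1) := (f : HomCarrier _ _)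
    have hf : ∀ σ, τX.homRep (mu (w.adicCompletion K) (p ^ 1)) σ (f : HomCarrier _ _) = f := f.2
    have heq : ∀ (σ : absoluteGaloisGroup (w.adicCompletion K)) (x : Φ.twistedFil (p := p) (m := m) 1),
        f₀ (τX σ x) = mu (w.adicCompletion K) (p ^ 1) σ (f₀ x) := fun σ x ↦
      (((ContinuousRep.homRep_apply_eq_self_iff τX _ σ _).mp (hf σ)) x).symm
    have h := Φ.forall_equivariant_twistedFil_one_eq_zero κ hm (fun σ ↦ (mu (w.adicCompletion K) (p ^ 1) σ).toAddMonoidHom)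
      hN f₀ (fun σ x ↦ (congrArg f₀ (Subtype.ext rfl)).trans (heq σ x))
    exact h
  haveI : Subsingleton (τX.homRep (mu (w.adicCompletion K) (p ^ 1))).toTopRep.ρ.invariants :=
    ⟨fun a b ↦ by rw [hinv a, hinv b]⟩
  haveI := hfin
  have h1 : Nat.card (continuousCohomology 2 τX.toTopRep) = 1 := by
    rw [hcard]; exact Nat.card_of_subsingleton 0
  exact (Nat.card_eq_one_iff_unique.mp h1).1

end OrdinaryFiltration

end ZpExtension

end Literature.NumberTheory.EllipticCurves

end
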